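import Mathlib
import HarnessLib
import Literature.MathematicalPhysics.QuantumFieldTheory.Balaban1983to89.Step
import Literature.MathematicalPhysics.QuantumFieldTheory.Balaban1983to89.B10Eq6PartitionLower
import Literature.MathematicalPhysics.QuantumFieldTheory.Balaban1983to89.UnitaryModel

/-!
# `Balaban1983to89.B10Eq6DensityLevel` — [Balaban1985UV3] p. 257, remark **(6)**, the LOWER half, on the cell's carrier
# of record for (6): *"The bounds (5) imply bounds for partition functions, i.e. for the integrals ∫dUρ_k(U), hence by
# normalization identities  ∫dUρ_k = ∫dUT^kρ₀ = ∫dUρ₀ = Z^ε  (6)  they imply uniform in ε bounds for the partition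
# function Z^ε."*

T. Bałaban, *Ultraviolet stability of three-dimensional lattice pure gauge field theories*, Commun. Math. Phys. **102**,
255–275 (1985) [Balaban1985UV3] (cell paper B10; journal page = PDF page + 254; pp. 256–257 re-read on the renders
`run/shared/lean/pub/pub-balaban/b2b-balaban-ref1/pages/1985-cmp102-uv-stability-3d/…-p002-x2.png`, `…-p003-x2.png`,
2026-08-21).

HONEST FRAMING (mega-formalization `lit-balaban`, verbatim): statement-level skeleton of published theorems with
citation tags; proofs where landed; nothing here is a claim about the Yang–Mills mass gap.

WHY THIS FILE EXISTS.  Unit `lit-balaban-r07` (reader/typer of B10, fold owner), gen 7; SKELETON row B10.Eq6.  The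
identity of (6), `∫dV_Kρ_K = ∫dUρ₀ = Z`, is formalized at the DENSITY LEVEL of the cell (`…Step.DensityRG`: the
sequence `ρ_{k+1} = 𝐑_k(T_kρ_k)` over the product Haar measure `fieldMeasure` of `…Setup`; `Step.DensityRG.integral_invariant`,
`Step.DensityRG.partitionFn`), where the UPPER half of the sentence is `Step.DensityRG.partitionFn_le_exp` (ρ_K ≤ e^{c}
⇒ Z ≤ e^{c}) and `Step.DensityRG.log_wilsonZ_sub_le` (*"the upper UV bound pins E from below"*).  The sibling
`…B10Eq6PartitionLower` (same gen) proved the LOWER half on the concrete torus carrier of `…ConstructiveQFTWave0`.  This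
file transports it to the carrier of record, so that the lower half meets (6) BY NAME: the small-field domain (4) on
`GaugeField P K G` (deviation `GaugeGroup.dist1 = |· − 1|`, B7 (19), whose subadditivity `dist1_mul_le` and inversion
invariance `dist1_inv` are fields of the class), its bondwise-small product subset, the volume
`fieldMeasure (bondwise) = haar{dist1 < δ}^{#bonds}`, and **`partitionFn_ge`**: if `e^{−c} ≤ ρ_K` on the domain (4) (the
lower bound of (3)/(5)_K) then `e^{−c}·haar{dist1 < ε₁/4}^{#bonds} ≤ Z`; for a Wilson start (`IsWilsonStart g₀ E`,
`Z = e^{−E}Z_W(g₀)`) this PINS THE VACUUM-ENERGY CONSTANT FROM ABOVE, `E ≤ log Z_W(g₀) + c + #bonds·log m⁻¹`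
(`le_log_wilsonZ_add`) — the partner of `Step.DensityRG.log_wilsonZ_sub_le` (cell GAPS G-pv06-1: E is not free).

CARRIER NOTE.  On `…Setup` the Haar measure is DATA (`HaarData.haar`, a probability measure with the invariances as
fields) over a bare `[MeasurableSpace G]` — no topology — so the two facts *"{dist1 < δ} is measurable"* and
*"haar{dist1 < δ} > 0"* cannot be derived there and enter as hypotheses (`hS`, `hm`); for a concrete compact `G ⊂ U(N)`
with its Borel structure and normalised Haar measure they are `…B10Eq6PartitionLower.measurableSet_devLt` /
`.haar_devLt_pos` (open-positivity of Haar measure).  Integrability of `ρ_K` is needed for the Bochner-integral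
`partitionFn` (the upper half avoided it because a non-integrable density has integral 0).

DICTIONARY print ↦ Lean: `T₁^{(K)}` ↦ `T^{(K)}` of `Setup` (`Site P K`, bonds `PBond P K`); `U(∂p)` ↦ `GaugeField.plaqHol U p`;
`|U(∂p) − 1|` ↦ `dist1 (U.plaqHol p)`; the domain (4) ↦ `plaqSmall P K ε₁`; `dU` ↦ `fieldMeasure P K G`;
`Z^ε = ∫dUρ₀` ↦ `Step.DensityRG.partitionFn`; `Z_W(g₀)` ↦ `Step.wilsonZ P G g₀`.

WHAT THIS FILE PROVES (kernel, no `sorry`; two set definitions, theorems otherwise; no named facts; axioms standard):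
`dist1_plaqHol_le`, `bondSmall_subset_plaqSmall`, `bondSmall_eq_pi`, `measurableSet_bondSmall`, `fieldMeasure_bondSmall`,
`integral_ge_of_lower` (any density at any level), `partitionFn_ge` (density level, via `integral_invariant`),
`partitionFn_two_sided` (with `partitionFn_le_exp`), `exp_neg_mul_wilsonZ_ge` and `le_log_wilsonZ_add` (Wilson start: E
pinned from above), `partitionFn_ge_of_bounds5` ((5)_K in the shape of `…B10.Bounds5At` with χ = 1 on (4) and the
[7]-regularity input, as in `…B10Ineq3Terminal`); §3 the side inputs discharged for the paper's groups via `…UnitaryModel`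
(`measurableSet_dist1Lt` for any `RegularGaugeGroup`, `haar_dist1Lt_pos_unitaryGroup` / `_specialUnitaryGroup`,
`partitionFn_ge_unitaryGroup`, `le_log_wilsonZ_add_unitaryGroup`).

Value = SKELETON row B10.Eq6: the lower half of the printed sentence now meets the formalized identity (6) by name; NOT
summit progress.
-/

noncomputable section

namespace Literature.MathematicalPhysics.QuantumFieldTheory.Balaban1983to89.B10Eq6DensityLevel

open _root_.MeasureTheory
open scoped ENNReal
open Literature.MathematicalPhysics.QuantumFieldTheory.Balaban1983to89
open Literature.MathematicalPhysics.QuantumFieldTheory.Balaban1983to89.Step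

variable {P : Params} {G : Type*} [GaugeGroup G]

/-! ## §1 The domain (4) and its bondwise-small product subset on `GaugeField P j G` -/

section Domain

variable (P G)

/-- The small-field domain **(4)** p. 256 on `T^{(j)}` of `Setup`: *"|U(∂p) − 1| < ε₁, p ⊂ T₁^{(K)}"* — every (positively
oriented) plaquette variable deviates from `1` by less than `ε₁` in `dist1 = |· − 1|` (B7 (19)). [cite: Balaban1985UV3, (4) p.256] -/
def plaqSmall (j : ℕ) (ε₁ : ℝ) : Set (GaugeField P j G) :=
  {U | ∀ p : Plaq P j, dist1 (GaugeField.plaqHol U p) < ε₁}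

/-- The bondwise-small set `{U : |U(b) − 1| < δ for every bond b}` — a product of identical windows, one per bond; the
device for bounding the Haar volume of (4) from below. (elementary; serves the domain (4) / remark (6))
[cite: Balaban1985UV3, (4) p.256] -/
def bondSmall (j : ℕ) (δ : ℝ) : Set (GaugeField P j G) :=
  {U | ∀ b : PBond P j, dist1 (U b) < δ}

variable {P G}

/-- Unfolding of `plaqSmall`. (elementary; serves the domain (4) / remark (6)) [cite: Balaban1985UV3, (4) p.256] -/
theorem mem_plaqSmall {j : ℕ} {ε₁ : ℝ} {U : GaugeField P j G} :
    U ∈ plaqSmall P G j ε₁ ↔ ∀ p : Plaq P j, dist1 (GaugeField.plaqHol U p) < ε₁ := Iff.rfl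

/-- Unfolding of `bondSmall`. (elementary; serves the domain (4) / remark (6)) [cite: Balaban1985UV3, (4) p.256] -/
theorem mem_bondSmall {j : ℕ} {δ : ℝ} {U : GaugeField P j G} :
    U ∈ bondSmall P G j δ ↔ ∀ b : PBond P j, dist1 (U b) < δ := Iff.rfl

/-- **Subadditivity along the plaquette boundary** for `dist1` (fields `dist1_mul_le`, `dist1_inv` of `GaugeGroup`):
`|U(∂p) − 1| ≤ Σ_{b∈∂p} |U(b) − 1|`. (elementary; serves the domain (4) / remark (6)) [cite: Balaban1985UV3, (4) p.256] -/
theorem dist1_plaqHol_le {j : ℕ} (U : GaugeField P j G) (p : Plaq P j) :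
    dist1 (GaugeField.plaqHol U p) ≤
      dist1 (U ⟨p.src, p.μ⟩) + dist1 (U ⟨p.src.shift p.μ, p.ν⟩) + dist1 (U ⟨p.src.shift p.ν, p.μ⟩) +
        dist1 (U ⟨p.src, p.ν⟩) := by
  unfold GaugeField.plaqHol
  calc dist1 (U ⟨p.src, p.μ⟩ * U ⟨p.src.shift p.μ, p.ν⟩ * (U ⟨p.src.shift p.ν, p.μ⟩)⁻¹ * (U ⟨p.src, p.ν⟩)⁻¹)
      ≤ dist1 (U ⟨p.src, p.μ⟩ * U ⟨p.src.shift p.μ, p.ν⟩ * (U ⟨p.src.shift p.ν, p.μ⟩)⁻¹) +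
          dist1 (U ⟨p.src, p.ν⟩)⁻¹ := GaugeGroup.dist1_mul_le _ _
    _ ≤ (dist1 (U ⟨p.src, p.μ⟩ * U ⟨p.src.shift p.μ, p.ν⟩) + dist1 (U ⟨p.src.shift p.ν, p.μ⟩)⁻¹) +
          dist1 (U ⟨p.src, p.ν⟩)⁻¹ := by
        gcongr
        exact GaugeGroup.dist1_mul_le _ _
    _ ≤ ((dist1 (U ⟨p.src, p.μ⟩) + dist1 (U ⟨p.src.shift p.μ, p.ν⟩)) + dist1 (U ⟨p.src.shift p.ν, p.μ⟩)) +
          dist1 (U ⟨p.src, p.ν⟩) := by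
        rw [GaugeGroup.dist1_inv, GaugeGroup.dist1_inv]
        gcongr
        exact GaugeGroup.dist1_mul_le _ _

/-- **The domain (4) contains the product set:** bondwise deviation `< δ` with `4δ ≤ ε₁` ⇒ every plaquette deviation
`< ε₁`. [cite: Balaban1985UV3, (4) p.256] -/
theorem bondSmall_subset_plaqSmall {j : ℕ} {δ ε₁ : ℝ} (h4 : 4 * δ ≤ ε₁) :
    bondSmall P G j δ ⊆ plaqSmall P G j ε₁ := by
  intro U hU p
  have hp := dist1_plaqHol_le U p
  have h1 := hU ⟨p.src, p.μ⟩
  have h2 := hU ⟨p.src.shift p.μ, p.ν⟩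
  have h3 := hU ⟨p.src.shift p.ν, p.μ⟩
  have h4' := hU ⟨p.src, p.ν⟩
  linarith

/-- `bondSmall` is the product set `Π_b {g : |g − 1| < δ}`. (elementary; serves the domain (4) / remark (6))
[cite: Balaban1985UV3, (4) p.256] -/
theorem bondSmall_eq_pi (j : ℕ) (δ : ℝ) :
    bondSmall P G j δ = Set.univ.pi (fun _ : PBond P j => {g : G | dist1 g < δ}) := by
  ext U
  exact ⟨fun h b _ => h b, fun h b => h b (Set.mem_univ _)⟩

/-- `bondSmall` is measurable once the window `{dist1 < δ}` is (product σ-algebra). (elementary; serves the domain (4) /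
remark (6)) [cite: Balaban1985UV3, (4) p.256] -/
theorem measurableSet_bondSmall [MeasurableSpace G] (j : ℕ) {δ : ℝ} (hS : MeasurableSet {g : G | dist1 g < δ}) :
    MeasurableSet (bondSmall P G j δ) := by
  rw [bondSmall_eq_pi]
  exact MeasurableSet.univ_pi fun _ => hS

/-- **Volume of the product set under `dU = Π_b d(haar)`:** `fieldMeasure (bondSmall δ) = haar{dist1 < δ}^{#bonds}`.
(elementary step of our proof of the sentence) [cite: Balaban1985UV3, (6) p.257] -/
theorem fieldMeasure_bondSmall [MeasurableSpace G] [HaarData G] (j : ℕ) (δ : ℝ) :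
    fieldMeasure P j G (bondSmall P G j δ) =
      (HaarData.haar : Measure G) {g : G | dist1 g < δ} ^ Fintype.card (PBond P j) := by
  haveI : IsProbabilityMeasure (HaarData.haar : Measure G) := HaarData.isProb
  rw [bondSmall_eq_pi]
  change (Measure.pi fun _ : PBond P j => (HaarData.haar : Measure G))
      (Set.univ.pi fun _ : PBond P j => {g : G | dist1 g < δ}) = _
  rw [Measure.pi_pi, Finset.prod_const, Finset.card_univ]

end Domain

/-! ## §2 The lower bound for the integral of a density and for the partition function `Z` -/

section Lower

variable [MeasurableSpace G] [HaarData G]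

/-- **Any level `j`:** if a non-negative integrable density `ρ` is `≥ e^{−c}` on the domain (4) `plaqSmall ε₁`, then for
`4δ ≤ ε₁` and a measurable window, `e^{−c}·(haar{dist1 < δ})^{#bonds} ≤ ∫dU ρ(U)`. [cite: Balaban1985UV3, (6) p.257] -/
theorem integral_ge_of_lower {j : ℕ} {ρ : Density P j G} (hint : Integrable ρ (fieldMeasure P j G))
    (h0 : ∀ U, 0 ≤ ρ U) {δ ε₁ c : ℝ} (h4 : 4 * δ ≤ ε₁) (hS : MeasurableSet {g : G | dist1 g < δ})
    (h3 : ∀ U ∈ plaqSmall P G j ε₁, Real.exp (-c) ≤ ρ U) :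
    Real.exp (-c) * (((HaarData.haar : Measure G) {g : G | dist1 g < δ}).toReal) ^ Fintype.card (PBond P j) ≤
      ∫ U, ρ U ∂(fieldMeasure P j G) := by
  have h := B10Eq6PartitionLower.mul_measure_le_integral (fieldMeasure P j G) hint
    (measurableSet_bondSmall j hS) (fun U hU => h3 U (bondSmall_subset_plaqSmall h4 hU)) h0
  rwa [fieldMeasure_bondSmall, ENNReal.toReal_pow] at h

variable {av : ∀ j, Averaging P j G}

/-- **Remark (6), lower half, at the density level of record.**  For the sequence `ρ_{k+1} = 𝐑_k(T_kρ_k)`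
(`Step.DensityRG`) with normalised large-field operations (`PreservesIntegral`, so that `∫dV_Kρ_K = Z`,
`Step.DensityRG.integral_invariant` = the identity (6)), an integrable non-negative `ρ_K` which is `≥ e^{−c}` on the
domain (4) (the lower bound of (3) = (5) at `k = K`, p. 256) gives `e^{−c}·haar{dist1 < δ}^{#bonds} ≤ Z` (`4δ ≤ ε₁`).
Companion of `Step.DensityRG.partitionFn_le_exp` (upper half). [cite: Balaban1985UV3, (6) p.257] -/
theorem partitionFn_ge (D : DensityRG P G av) (K : ℕ) (hR : ∀ k, k < K → PreservesIntegral (D.R k))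
    (hint : Integrable (D.ρ K) (fieldMeasure P K G)) (h0 : ∀ U, 0 ≤ D.ρ K U) {δ ε₁ c : ℝ} (h4 : 4 * δ ≤ ε₁)
    (hS : MeasurableSet {g : G | dist1 g < δ}) (h3 : ∀ U ∈ plaqSmall P G K ε₁, Real.exp (-c) ≤ D.ρ K U) :
    Real.exp (-c) * (((HaarData.haar : Measure G) {g : G | dist1 g < δ}).toReal) ^ Fintype.card (PBond P K) ≤
      D.partitionFn := by
  rw [← D.integral_invariant K hR K le_rfl]
  exact integral_ge_of_lower hint h0 h4 hS h3

/-- **Both halves of remark (6) at the density level:** the two-sided pointwise bound (3) on `T^{(K)}` —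
`e^{−c} ≤ ρ_K` on the domain (4), `ρ_K ≤ e^{c′}` everywhere — gives `e^{−c}·m^{#bonds} ≤ Z ≤ e^{c′}`,
`m = haar{dist1 < δ}`. [cite: Balaban1985UV3, (3) p.256, (6) p.257] -/
theorem partitionFn_two_sided (D : DensityRG P G av) (K : ℕ) (hR : ∀ k, k < K → PreservesIntegral (D.R k))
    (hint : Integrable (D.ρ K) (fieldMeasure P K G)) (h0 : ∀ U, 0 ≤ D.ρ K U) {δ ε₁ c c' : ℝ} (h4 : 4 * δ ≤ ε₁)
    (hS : MeasurableSet {g : G | dist1 g < δ}) (h3 : ∀ U ∈ plaqSmall P G K ε₁, Real.exp (-c) ≤ D.ρ K U)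
    (hup : ∀ U, D.ρ K U ≤ Real.exp c') :
    Real.exp (-c) * (((HaarData.haar : Measure G) {g : G | dist1 g < δ}).toReal) ^ Fintype.card (PBond P K) ≤
        D.partitionFn ∧ D.partitionFn ≤ Real.exp c' :=
  ⟨partitionFn_ge D K hR hint h0 h4 hS h3, D.partitionFn_le_exp K c' hR hup⟩

/-- **Wilson start:** with `ρ₀ = exp[−(1/g₀²)A − E]` ((1) p. 256; `Z = e^{−E}·Z_W(g₀)`,
`Step.DensityRG.partitionFn_eq_of_wilsonStart`) the lower half reads `e^{−c}·m^{#bonds} ≤ e^{−E}·Z_W(g₀)`.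
[cite: Balaban1985UV3, (1) p.256, (6) p.257] -/
theorem exp_neg_mul_wilsonZ_ge (D : DensityRG P G av) (K : ℕ) {g₀ E : ℝ} (hW : D.IsWilsonStart g₀ E)
    (hR : ∀ k, k < K → PreservesIntegral (D.R k)) (hint : Integrable (D.ρ K) (fieldMeasure P K G))
    (h0 : ∀ U, 0 ≤ D.ρ K U) {δ ε₁ c : ℝ} (h4 : 4 * δ ≤ ε₁) (hS : MeasurableSet {g : G | dist1 g < δ})
    (h3 : ∀ U ∈ plaqSmall P G K ε₁, Real.exp (-c) ≤ D.ρ K U) :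
    Real.exp (-c) * (((HaarData.haar : Measure G) {g : G | dist1 g < δ}).toReal) ^ Fintype.card (PBond P K) ≤
      Real.exp (-E) * wilsonZ P G g₀ := by
  rw [← D.partitionFn_eq_of_wilsonStart hW]
  exact partitionFn_ge D K hR hint h0 h4 hS h3

/-- **THE LOWER UV BOUND PINS `E` FROM ABOVE** (partner of `Step.DensityRG.log_wilsonZ_sub_le`, which pins it from below;
cell GAPS G-pv06-1: the vacuum-energy constant is not free): with `m = haar{dist1 < δ} > 0` and `n = #bonds`,
`E ≤ log Z_W(g₀) + c + n·log m⁻¹`. [cite: Balaban1985UV3, (6) p.257] -/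
theorem le_log_wilsonZ_add (D : DensityRG P G av) (K : ℕ) {g₀ E : ℝ} (hW : D.IsWilsonStart g₀ E)
    (hR : ∀ k, k < K → PreservesIntegral (D.R k)) (hint : Integrable (D.ρ K) (fieldMeasure P K G))
    (h0 : ∀ U, 0 ≤ D.ρ K U) {δ ε₁ c : ℝ} (h4 : 4 * δ ≤ ε₁) (hS : MeasurableSet {g : G | dist1 g < δ})
    (hm : 0 < ((HaarData.haar : Measure G) {g : G | dist1 g < δ}).toReal)
    (h3 : ∀ U ∈ plaqSmall P G K ε₁, Real.exp (-c) ≤ D.ρ K U) :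
    E ≤ Real.log (wilsonZ P G g₀) + c +
      (Fintype.card (PBond P K) : ℝ) * Real.log ((HaarData.haar : Measure G) {g : G | dist1 g < δ}).toReal⁻¹ := by
  set m : ℝ := ((HaarData.haar : Measure G) {g : G | dist1 g < δ}).toReal with hm_def
  set n : ℕ := Fintype.card (PBond P K) with hn_def
  have h := exp_neg_mul_wilsonZ_ge D K hW hR hint h0 h4 hS h3
  -- the left side is positive, hence so is Z_W(g₀)
  have hlhs : 0 < Real.exp (-c) * m ^ n := mul_pos (Real.exp_pos _) (pow_pos hm n)
  have hZ : 0 < wilsonZ P G g₀ := by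
    have h1 : 0 < Real.exp (-E) * wilsonZ P G g₀ := lt_of_lt_of_le hlhs h
    exact pos_of_mul_pos_right h1 (Real.exp_pos _).le
  -- take logarithms
  have hlog := Real.log_le_log hlhs h
  rw [Real.log_mul (Real.exp_pos _).ne' (pow_pos hm n).ne', Real.log_exp, Real.log_pow,
    Real.log_mul (Real.exp_pos _).ne' hZ.ne', Real.log_exp] at hlog
  rw [Real.log_inv]
  linarith

/-- **(5) at `k = K` ⇒ the lower bound for `Z`** at the density level, in the shape of `…B10.Bounds5At` (cf.
`…B10Eq6PartitionLower.partition_lower_of_bounds5`, `…B10Ineq3Terminal.ineq3_of_bounds5At`): if `χ = 1` on the domain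
(4), `χ(U)·exp[−g_K^{−2}A(U) − O1·S] ≤ ρ_K(U)` pointwise and `A ≤ a·S` on (4) (the [7]-regularity input; `S` = `|T₁^{(K)}|`),
then `exp(−(O1 + a·g_K^{−2})·S)·m^{#bonds} ≤ Z`. [cite: Balaban1985UV3, (5) p.256, (6) p.257] -/
theorem partitionFn_ge_of_bounds5 (D : DensityRG P G av) (K : ℕ) (hR : ∀ k, k < K → PreservesIntegral (D.R k))
    (hint : Integrable (D.ρ K) (fieldMeasure P K G)) (h0 : ∀ U, 0 ≤ D.ρ K U) {δ ε₁ : ℝ} (h4 : 4 * δ ≤ ε₁)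
    (hS : MeasurableSet {g : G | dist1 g < δ}) {χ A : Density P K G} {gK O1 a S : ℝ}
    (hχ : ∀ U ∈ plaqSmall P G K ε₁, χ U = 1)
    (h5 : ∀ U, χ U * Real.exp (-(gK⁻¹ ^ 2 * A U) - O1 * S) ≤ D.ρ K U)
    (hreg : ∀ U ∈ plaqSmall P G K ε₁, A U ≤ a * S) :
    Real.exp (-((O1 + a * gK⁻¹ ^ 2) * S)) *
        (((HaarData.haar : Measure G) {g : G | dist1 g < δ}).toReal) ^ Fintype.card (PBond P K) ≤ D.partitionFn := by
  refine partitionFn_ge D K hR hint h0 h4 hS (c := (O1 + a * gK⁻¹ ^ 2) * S) fun U hU => ?_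
  have h := h5 U
  rw [hχ U hU, one_mul] at h
  refine le_trans (Real.exp_le_exp.mpr ?_) h
  have hA := hreg U hU
  have hg : 0 ≤ gK⁻¹ ^ 2 := sq_nonneg _
  nlinarith [mul_le_mul_of_nonneg_left hA hg]

end Lower

/-! ## §3 The inputs `hS`, `hm` DISCHARGED for the paper's groups `U(N)`, `SU(N)` (`…UnitaryModel` instances) -/

section Concrete

/-- For a `RegularGaugeGroup` (`…UnitaryModel`: `dist1` measurable) the window `{dist1 < δ}` is measurable — the input `hS`.
(elementary; serves the domain (4) / remark (6)) [cite: Balaban1985UV3, (4) p.256] -/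
theorem measurableSet_dist1Lt {G : Type*} [GaugeGroup G] [MeasurableSpace G] [RegularGaugeGroup G] (δ : ℝ) :
    MeasurableSet {g : G | dist1 g < δ} :=
  measurableSet_lt RegularGaugeGroup.measurable_dist1 measurable_const

variable {n : Type*} [DecidableEq n] [Fintype n] [Nonempty n]

/-- On `U(N)` (`…UnitaryModel.instGaugeGroupUnitaryGroup`: `dist1 u = ‖u − 1‖_op`, `HaarData.haar` = the normalised Haar measure
`haarProbability`) the window `{dist1 < δ}`, `δ > 0`, has positive Haar volume — the input `hm`
(`…B10Eq6PartitionLower.haar_devLt_pos`). (elementary; serves the domain (4) / remark (6)) [cite: Balaban1985UV3, (6) p.257] -/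
theorem haar_dist1Lt_pos_unitaryGroup {δ : ℝ} (hδ : 0 < δ) :
    0 < (HaarData.haar : Measure (Matrix.unitaryGroup n ℂ)) {u | dist1 u < δ} := by
  have hset : {u : Matrix.unitaryGroup n ℂ | dist1 u < δ} = {u | B10Eq6PartitionLower.devU u < δ} := rfl
  have hμ : (HaarData.haar : Measure (Matrix.unitaryGroup n ℂ)) = haarProbability (Matrix.unitaryGroup n ℂ) := rfl
  rw [hμ, hset]
  exact B10Eq6PartitionLower.haar_devLt_pos B10Eq6PartitionLower.continuous_devU
    (by rw [B10Eq6PartitionLower.devU_one]; exact hδ)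

/-- The same on `SU(N)` (`…UnitaryModel.instGaugeGroupSpecialUnitaryGroup`). (elementary; serves the domain (4) / remark (6))
[cite: Balaban1985UV3, (6) p.257] -/
theorem haar_dist1Lt_pos_specialUnitaryGroup {δ : ℝ} (hδ : 0 < δ) :
    0 < (HaarData.haar : Measure (Matrix.specialUnitaryGroup n ℂ)) {u | dist1 u < δ} := by
  have hset : {u : Matrix.specialUnitaryGroup n ℂ | dist1 u < δ} = {u | B10Eq6PartitionLower.devSU u < δ} := rfl
  have hμ : (HaarData.haar : Measure (Matrix.specialUnitaryGroup n ℂ)) =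
      haarProbability (Matrix.specialUnitaryGroup n ℂ) := rfl
  rw [hμ, hset]
  exact B10Eq6PartitionLower.haar_devLt_pos B10Eq6PartitionLower.continuous_devSU
    (by rw [B10Eq6PartitionLower.devSU_one]; exact hδ)

variable {P : Params} {av : ∀ j, Averaging P j (Matrix.unitaryGroup n ℂ)}

/-- **Remark (6), lower half, density level, `G = U(N)`, no side inputs left:** for the sequence `ρ_{k+1} = 𝐑_k(T_kρ_k)` with
normalised `𝐑`'s and an integrable non-negative `ρ_K` that is `≥ e^{−c}` on the domain (4) (`|U(∂p) − 1|_op < ε₁` for all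
plaquettes of `T^{(K)}`), `0 < m = Haar{|u − 1| < ε₁/4}` and `e^{−c}·m^{#bonds} ≤ Z`. [cite: Balaban1985UV3, (6) p.257] -/
theorem partitionFn_ge_unitaryGroup (D : DensityRG P (Matrix.unitaryGroup n ℂ) av) (K : ℕ)
    (hR : ∀ k, k < K → PreservesIntegral (D.R k)) (hint : Integrable (D.ρ K) (fieldMeasure P K _))
    (h0 : ∀ U, 0 ≤ D.ρ K U) {ε₁ c : ℝ} (hε₁ : 0 < ε₁)
    (h3 : ∀ U ∈ plaqSmall P (Matrix.unitaryGroup n ℂ) K ε₁, Real.exp (-c) ≤ D.ρ K U) :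
    0 < ((HaarData.haar : Measure (Matrix.unitaryGroup n ℂ)) {u | dist1 u < ε₁ / 4}).toReal ∧
      Real.exp (-c) * (((HaarData.haar : Measure (Matrix.unitaryGroup n ℂ)) {u | dist1 u < ε₁ / 4}).toReal) ^
          Fintype.card (PBond P K) ≤ D.partitionFn := by
  haveI : IsProbabilityMeasure (HaarData.haar : Measure (Matrix.unitaryGroup n ℂ)) := HaarData.isProb
  refine ⟨?_, partitionFn_ge D K hR hint h0 (by linarith) (measurableSet_dist1Lt _) h3⟩
  exact ENNReal.toReal_pos (haar_dist1Lt_pos_unitaryGroup (by positivity)).ne' (measure_ne_top _ _)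

/-- `G = U(N)`, Wilson start: **`E ≤ log Z_W(g₀) + c + #bonds·log m⁻¹`** with every side input discharged (the partner of
`Step.DensityRG.log_wilsonZ_sub_le`). [cite: Balaban1985UV3, (6) p.257] -/
theorem le_log_wilsonZ_add_unitaryGroup (D : DensityRG P (Matrix.unitaryGroup n ℂ) av) (K : ℕ) {g₀ E : ℝ}
    (hW : D.IsWilsonStart g₀ E) (hR : ∀ k, k < K → PreservesIntegral (D.R k))
    (hint : Integrable (D.ρ K) (fieldMeasure P K _)) (h0 : ∀ U, 0 ≤ D.ρ K U) {ε₁ c : ℝ} (hε₁ : 0 < ε₁)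
    (h3 : ∀ U ∈ plaqSmall P (Matrix.unitaryGroup n ℂ) K ε₁, Real.exp (-c) ≤ D.ρ K U) :
    E ≤ Real.log (wilsonZ P (Matrix.unitaryGroup n ℂ) g₀) + c +
      (Fintype.card (PBond P K) : ℝ) *
        Real.log ((HaarData.haar : Measure (Matrix.unitaryGroup n ℂ)) {u | dist1 u < ε₁ / 4}).toReal⁻¹ :=
  le_log_wilsonZ_add D K hW hR hint h0 (by linarith) (measurableSet_dist1Lt _)
    (partitionFn_ge_unitaryGroup D K hR hint h0 hε₁ h3).1 h3

end Concrete

end Literature.MathematicalPhysics.QuantumFieldTheory.Balaban1983to89.B10Eq6DensityLevel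

end
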